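import Literature.AnabelianGeometry.SemiGraphs.IsolatedEdgeSectionMono

/-!
# The EDGE section map of a print-covering is a monomorphism at EVERY edge
# ([SemiAnbd] Def. 2.2 (i) p. 23, Rem. 2.2.1 p. 24)

Mochizuki, *Semi-graphs of anabelioids*, Publ. RIMS **42** (2006) 221–322, §2 Def. 2.2 (i) p. 23,
Rem. 2.2.1 p. 24 [cite: MochizukiSemiAnbd2006, Rem. 2.2.1 p.24].

PROOF-ONLY companion (abc-iut cell, layer L3; FACT-LIST row F-1478 `remark_2_4_1_covering`, residual
(L)/(J1), sub-brick (L-σ) at EDGES; seat abc-iut-w4-d079).  ONE statement for the consumer (abc-iut-w5-d041's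
Route W, step (L-S) at edges): for a covering `ψ : ℋ → 𝒦` which is LOCALLY the covering of `A`
(`Hom.IsFiniteEtaleCoveringOf` — only used to produce a local vertex witness at an abutting vertex),
BRANCH-ALIGNED and VERTEX-ALIGNED, with a global witness (`αψ`, `e_ψ`) and a local edge witness at ANY
edge `e′ ↦ f` on a connected `Q ↪ A_f` (`α_{e′}`, `e_{e′}`), the edge section map `σ_{e′}` of
`K_{e′} = αψ ⋙ ρ_{e′} ⋙ α_{e′}⁻¹` (its evident identification, `EdgeSectionBasePoint`) is a monomorphism:

* `Hom.sectionMapE_mono` — by cases: `e′` has a branch abutting to a vertex `w` ⇒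
  `IsBranchAligned.sectionMapE_mono` (`EdgeSectionMono`) at a local vertex witness taken from the local
  clause; no branch of `e′` abuts ⇒ `sectionMapE_mono_of_isolated` (`IsolatedEdgeSectionMono`, no
  alignment used).

No `def`, no new `Prop`; nothing here takes a side on [IUTchIII] Cor. 3.12.
-/

namespace Literature.AnabelianGeometry.SemiGraphs

namespace SemiGraphOfAnabelioids

namespace Hom

open CategoryTheory CategoryTheory.Limits CategoryTheory.PreGaloisCategory
open Literature.AnabelianGeometry.Anabelioids

universe v₁ u₁ u

variable {ℋ 𝒦 : SemiGraphOfAnabelioids.{v₁, u₁, u}}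

set_option backward.isDefEq.respectTransparency false in
/-- **(E-σ) at every edge.**  Let `ψ : ℋ → 𝒦` be locally the covering of `A ∈ B(𝒦)`, branch-aligned and
vertex-aligned, with a global witness `αψ : B(𝒦)_{/A} ⥲ B(ℋ)`, `e_ψ : ψ^* ≅ (A × −) ⋙ αψ`; let `e′ ↦ f`
(`p : ψ e′ = f`) be ANY edge of `ℋ` with a local edge witness `α_{e′} : (𝒦_f)_{/Q} ⥲ ℋ_{e′}`, `e_{e′}` on a
CONNECTED `Q ↪ A_f`.  Then the edge section map `σ_{e′} : Q ⟶ A_f` of `K_{e′} = αψ ⋙ ρ_{e′} ⋙ α_{e′}⁻¹`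
with its evident identification is a monomorphism (for any terminality witness `hT`): at an edge with an
abutting branch by branch + vertex alignment, at an isolated edge unconditionally.
[cite: MochizukiSemiAnbd2006, Rem. 2.2.1 p.24] -/
theorem sectionMapE_mono (ψ : Hom ℋ 𝒦) (A : 𝒦.BObj) [HasBinaryProducts 𝒦.BObj]
    (αψ : Over A ⥤ ℋ.BObj) [αψ.IsEquivalence] (eψ : ψ.pullbackFunctor ≅ Over.star A ⋙ αψ)
    (hloc : ψ.IsFiniteEtaleCoveringOf A) (hal : ψ.IsBranchAligned) (hva : ψ.IsVertexAligned)
    (e' : ℋ.graph.Edge) (f : 𝒦.graph.Edge) (p : ψ.base.edgeMap e' = f)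
    {Q : 𝒦.E f} [PreGaloisCategory.IsConnected Q] (mQ : Q ⟶ A.T f) [Mono mQ]
    (αE : Over Q ⥤ ℋ.E e') [αE.IsEquivalence]
    (eEloc : (ψ.φE e' f p).pullback ≅ Over.star Q ⋙ αE)
    (hT : IsTerminal ((αψ ⋙ ℋ.ρE e' ⋙ αE.inv).obj (Over.mk (𝟙 A)))) :
    Mono (OverStar.sectionMap (Over.forgetAdjStar A) (Over.forgetAdjStar Q)
      (αψ ⋙ ℋ.ρE e' ⋙ αE.inv) (𝒦.ρE f)
      (Functor.isoWhiskerRight eψ.symm (ℋ.ρE e' ⋙ αE.inv) ≪≫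
        Functor.isoWhiskerRight (ψ.reindexIso e' (ψ.base.edgeMap e') f rfl p) αE.inv ≪≫
        Functor.isoWhiskerLeft (𝒦.ρE f) (Functor.isoWhiskerRight eEloc αE.inv) ≪≫
        Functor.isoWhiskerLeft (𝒦.ρE f ⋙ Over.star Q) αE.asEquivalence.unitIso.symm :
          Over.star A ⋙ (αψ ⋙ ℋ.ρE e' ⋙ αE.inv) ≅ 𝒦.ρE f ⋙ Over.star Q) hT) := by
  by_cases h : ∃ (b' : ℋ.graph.Branch) (w : ℋ.graph.Vertex),
      ℋ.graph.edgeOf b' = e' ∧ ℋ.graph.abuts b' = some w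
  · -- an abutting branch: the vertex + branch aligned statement at a local vertex witness
    obtain ⟨b', w, hb', hw⟩ := h
    subst hb'
    have hf : f = 𝒦.graph.edgeOf (ψ.base.branchMap b') :=
      p.symm.trans (ψ.edgeMap_edgeOf_of_branchMap b' _ rfl)
    subst hf
    obtain ⟨-, cV, -, -, -, hV, -, -⟩ := hloc
    obtain ⟨αw, hαw, ⟨ew⟩⟩ := hV w
    haveI := hαw
    exact hal.sectionMapE_mono hva A αψ eψ w b' hw (ψ.base.branchMap b') rfl (cV w).1.arrow αw ew mQ
      αE eEloc hT
  · -- no abutting branch: the isolated statement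
    refine ψ.sectionMapE_mono_of_isolated A αψ eψ e' (fun b hb => ?_) f p mQ αE eEloc hT
    cases hb'' : ℋ.graph.abuts b with
    | none => rfl
    | some v => exact absurd ⟨b, v, hb, hb''⟩ h

end Hom

end SemiGraphOfAnabelioids

end Literature.AnabelianGeometry.SemiGraphs
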